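import Summits.QuantumFields.YangMills.Theses.SmallCircleAnchor

/-!
# `AdiabaticContinuity` (stmt-QuantumFields-11142) — negative lemma: a deconfined window on Leg A is fatal

Negative side of the crux `Summit.QuantumFields.YangMills.Theses.SmallCircleAnchor.AdiabaticContinuity`
(route SmallCircleAnchor, rank 3), filed by the fifth line lead (c4, 2026-08-17) of line `registered`.

`ThermalWindowLRO` (the hypothesis `H`, a closed `Prop`) says: there is ONE admissible instance of the crux's
prefix — a compact simple `G`, a faithful unitary `r`, an abelianising class function `V`, an anchor extent `T` —
such that for EVERY deformation floor `ε₁` some schedule `E ≥ ε₁` has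

* (i) a clustering anchor: the `(T, E(β)·V)`-theory clusters uniformly in `L` for all large `β` — VERBATIM the
  crux's own hypothesis (= the conclusion of `AnchorGap` for this `V`, `E`); and
* (ii) long-range order somewhere on Leg A at arbitrarily large `β`: for every `β₁` there are `β ≥ β₁`, a temporal
  extent `T' ≥ T`, a cube side `w` and `δ > 0` such that on arbitrarily large spatial tori `(ℤ/L)³` two `w`-local
  observables bounded by `1` have connected correlation `≥ δ` at a distance `n` with `L ≤ 4n`, `2n < L`, in the
  `(T', E(β)·V)`-theory — the inline model VERBATIM the crux's (`Cl (fun _ => T') (E β) β m` with the inequality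
  reversed).

`AdiabaticContinuity_false_of_ThermalWindowLRO : ThermalWindowLRO → ¬ AdiabaticContinuity` is then bookkeeping plus
`C·e^{-m n} < δ` for large `n`: the crux hands back `β₁` and, for the `β ≥ β₁` of (ii), one rate `m > 0` whose Leg A
bound `C(w)·e^{-m n}` at the extent `T'` of (ii) contradicts (ii) along `L → ∞`.

Why `H` is the physically expected situation (lead c4 evidence `REFUTATION-c4.md` on the item; summary): the crux's
deformation is a single-site class function of the BARE Polyakov holonomy `P_x` (product of the `T'` time-like links).
At fixed `β` and `T' ≫ β` the bare holonomy is ultraviolet noise around the infrared holonomy: its law given the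
infrared background is a heat kernel of time `s² ≍ g² T' G₃(0) ∝ T'/β` (the perimeter-law renormalisation
`Z_λ(T') = exp(−C₂(λ) s²/2)` of Polyakov loops, Casimir-scaled), so ANY single-site reweighting `exp(−E β V(P_x))`,
including hard pinning `E β = +∞`, shifts the infrared holonomy potential by at most `O(Z_fund(T')) = O(e^{−c T'/β})`
per spatial site (`O(Z_adj(T'))` for a centre-symmetric `V`) — the reweighting saturates, it does not grow with
`E β` — while the one-loop (Gross–Pisarski–Yaffe/Weiss) potential that drives deconfinement is `≍ T'⁻³` per site. Hence for `C β log β ≲ T' < T'_c(β)` (`T'_c(β) ≍ e^{c'β}`, the deconfinement extent of the undeformed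
Wilson theory, Borgs–Seiler) the deformed theory is deconfined with the centre broken spontaneously for a
centre-symmetric abelianising `V` (e.g. `V = Σ_j |tr g^j|²` on `SU(N)`): Polyakov-loop long-range order, i.e. (ii),
for EVERY schedule `E`; and at the anchor extent `T` (fixed, `Z(T) → 1` as `β → ∞`) the pinning is fully effective,
which is the route's own reason to believe (i). No schedule `E(β)` closes the window (saturation at hard pinning), so
the continuity crux is not repaired by re-ordering `∃ ε₁`; a repair must deform SMEARED holonomies (support growing
with `T'`) or avoid the thermal window altogether.

`H` is not constructible in the tree today: (i) is an `AnchorGap`-type weak-coupling clustering statement and (ii) a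
Borgs–Seiler-type deconfinement statement for the PINNED theory (their sum rule (III.18) is exactly what pinning
breaks, so their proof does not transfer verbatim). This file records, kernel-checked, that the two together decide
the crux negatively; it introduces no axiom and no named fact.
-/

namespace Summit.QuantumFields.YangMills.Theorems.AdiabaticContinuity.Negative

open MeasureTheory

/-- **`H` — a clustering anchor together with long-range order in a thermal window on Leg A.** There is an admissible
instance `(G, r, V, T)` of the crux's prefix such that for every floor `ε₁` some schedule `E ≥ ε₁` has (i) the
anchor `(T, E(β)·V)` clustering uniformly in `L` for all large `β` (verbatim the crux's hypothesis) and (ii) for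
arbitrarily large `β` an extent `T' ≥ T`, a cube side `w` and `δ > 0` with `w`-local bounded observables of connected
correlation `≥ δ` at distance `n ≥ L/4` on arbitrarily large spatial tori in the `(T', E(β)·V)`-theory (the crux's
inline model verbatim). Physically: bare Polyakov-holonomy pinning renormalises away for `T' ≫ β log β`, below the
deconfinement extent `T'_c(β)`, where the centre breaks spontaneously (see the module docstring). -/
def ThermalWindowLRO : Prop :=
  ∃ (G : Type) (_ : Group G) (_ : TopologicalSpace G) (_ : IsTopologicalGroup G) (_ : CompactSpace G),
    Literature.MathematicalPhysics.QuantumFieldTheory.IsCompactSimpleLieGroup G ∧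
    letI : MeasurableSpace G := borel G
    haveI : BorelSpace G := ⟨rfl⟩
    ∃ (r : Literature.MathematicalPhysics.QuantumFieldTheory.LatticeRep G) (V : G → ℝ),
      (Continuous V ∧ (∀ a g : G, V (a * g * a⁻¹) = V g) ∧ ∃ g₀ : G, (∀ g : G, V g₀ ≤ V g) ∧
        (∀ g : G, V g = V g₀ → ∃ a : G, g = a * g₀ * a⁻¹) ∧
        (∀ a b : G, a * g₀ = g₀ * a → b * g₀ = g₀ * b → a * b = b * a)) ∧
      ∃ (T : ℕ) (_ : NeZero T), ∀ ε₁ : ℝ, ∃ E : ℝ → ℝ, (∀ β : ℝ, ε₁ ≤ E β) ∧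
        -- (i) the anchor clusters (verbatim the crux's hypothesis)
        (∃ β₀ : ℝ, ∀ β : ℝ, β₀ ≤ β → ∃ m : ℝ, 0 < m ∧ ∀ w : ℕ, ∃ C : ℝ, ∀ (L : ℕ) [NeZero L], let St := ZMod T × (Fin 3 → ZMod L); let Cfg := St × Option (Fin 3) → G; let ν : MeasureTheory.Measure Cfg := MeasureTheory.Measure.pi fun _ => Literature.MathematicalPhysics.QuantumFieldTheory.haarProbability G; let sh : St → Option (Fin 3) → St := fun x μ => Option.elim μ (x.1 + 1, x.2) fun i => (x.1, x.2 + Pi.single i 1); let pl : Cfg → St → Option (Fin 3) → Option (Fin 3) → G := fun U x μ κ => U (x, μ) * U (sh x μ, κ) * (U (sh x κ, μ))⁻¹ * (U (x, κ))⁻¹; let act : Cfg → ℝ := fun U => β * ∑ x : St, ∑ i : Fin 3, (r.ρ (pl U x none (some i))).trace.re + β * ∑ x : St, ∑ q : {q : Fin 3 × Fin 3 // q.1 < q.2}, (r.ρ (pl U x (some q.1.1) (some q.1.2))).trace.re; let P : Cfg → (Fin 3 → ZMod L) → G := fun U x => (List.ofFn fun t : Fin T => U ((((t : ℕ) : ZMod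 T), x), none)).prod; let wgt : Cfg → ℝ := fun U => Real.exp (act U - E β * ∑ x : Fin 3 → ZMod L, V (P U x)); let Ex : (Cfg → ℝ) → ℝ := fun F => (∫ U, F U * wgt U ∂ν) / (∫ U, wgt U ∂ν); let σ : ℕ → Cfg → Cfg := fun n U p => U ((p.1.1, p.1.2 + Pi.single 0 (n : ZMod L)), p.2); ∀ (c : Fin 3 → ZMod L), let Loc := fun F : Cfg → ℝ => Measurable F ∧ (∀ U, |F U| ≤ 1) ∧ ∀ U U', (∀ p, (∀ i : Fin 3, (p.1.2 i - c i).val ≤ w) → U p = U' p) → F U = F U'; ∀ F₁ F₂ : Cfg → ℝ, Loc F₁ → Loc F₂ → ∀ n : ℕ, 2 * n < L → |Ex (fun U => F₁ U * F₂ (σ n U)) - Ex F₁ * Ex (fun U => F₂ (σ n U))| ≤ C * Real.exp (-(m * n))) ∧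
        -- (ii) long-range order at some extent `T' ≥ T` on Leg A, at arbitrarily large `β`
        (∀ β₁ : ℝ, ∃ β : ℝ, β₁ ≤ β ∧ ∃ (T' : ℕ) (_ : NeZero T'), T ≤ T' ∧ ∃ (w : ℕ) (δ : ℝ), 0 < δ ∧
          ∀ L₀ : ℕ, ∃ (L : ℕ) (_ : NeZero L), L₀ ≤ L ∧
            let St := ZMod T' × (Fin 3 → ZMod L); let Cfg := St × Option (Fin 3) → G; let ν : MeasureTheory.Measure Cfg := MeasureTheory.Measure.pi fun _ => Literature.MathematicalPhysics.QuantumFieldTheory.haarProbability G; let sh : St → Option (Fin 3) → St := fun x μ => Option.elim μ (x.1 + 1, x.2) fun i => (x.1, x.2 + Pi.single i 1); let pl : Cfg → St → Option (Fin 3) → Option (Fin 3) → G := fun U x μ κ => U (x, μ) * U (sh x μ, κ) * (U (sh x κ, μ))⁻¹ * (U (x, κ))⁻¹; let act : Cfg → ℝ := fun U => β * ∑ x : St, ∑ i : Fin 3, (r.ρ (pl U x none (some i))).trace.re + β * ∑ x : St, ∑ q : {q : Fin 3 × Fin 3 // q.1 < q.2}, (r.ρ (pl U x (some q.1.1) (some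 q.1.2))).trace.re; let P : Cfg → (Fin 3 → ZMod L) → G := fun U x => (List.ofFn fun t : Fin T' => U ((((t : ℕ) : ZMod T'), x), none)).prod; let wgt : Cfg → ℝ := fun U => Real.exp (act U - E β * ∑ x : Fin 3 → ZMod L, V (P U x)); let Ex : (Cfg → ℝ) → ℝ := fun F => (∫ U, F U * wgt U ∂ν) / (∫ U, wgt U ∂ν); let σ : ℕ → Cfg → Cfg := fun n U p => U ((p.1.1, p.1.2 + Pi.single 0 (n : ZMod L)), p.2); ∃ (c : Fin 3 → ZMod L), let Loc := fun F : Cfg → ℝ => Measurable F ∧ (∀ U, |F U| ≤ 1) ∧ ∀ U U', (∀ p, (∀ i : Fin 3, (p.1.2 i - c i).val ≤ w) → U p = U' p) → F U = F U'; ∃ F₁ F₂ : Cfg → ℝ, Loc F₁ ∧ Loc F₂ ∧ ∃ n : ℕ, 2 * n < L ∧ L ≤ 4 * n ∧ δ ≤ |Ex (fun U => F₁ U * F₂ (σ n U)) - Ex F₁ * Ex (fun U => F₂ (σ n U))|)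

/-- Elementary: a bound `δ ≤ C·e^{-m n}` with `δ, m > 0` fails as soon as `C/(δ m) < n`. -/
theorem not_le_mul_exp_neg {δ m C : ℝ} {n : ℕ} (hδ : 0 < δ) (hm : 0 < m) (hn : C / (δ * m) < n) :
    ¬ δ ≤ C * Real.exp (-(m * n)) := by
  intro h
  have hexp : 0 < Real.exp (m * n) := Real.exp_pos _
  have h1 : δ * Real.exp (m * n) ≤ C := by
    have := mul_le_mul_of_nonneg_right h hexp.le
    rwa [mul_assoc, ← Real.exp_add, neg_add_cancel, Real.exp_zero, mul_one] at this
  have h2 : m * n + 1 ≤ Real.exp (m * n) := Real.add_one_le_exp _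
  have h3 : C < δ * m * n := by
    have hδm : 0 < δ * m := mul_pos hδ hm
    have := (div_lt_iff₀ hδm).1 hn
    linarith
  have h4 : δ * (m * n + 1) ≤ δ * Real.exp (m * n) := mul_le_mul_of_nonneg_left h2 hδ.le
  nlinarith

/-- **Negative lemma for the crux `AdiabaticContinuity` (stmt-QuantumFields-11142).** A clustering anchor that
coexists with long-range order somewhere on Leg A at arbitrarily large `β` (hypothesis `ThermalWindowLRO`) refutes
`AdiabaticContinuity`: the crux's `ε₁` is answered by the schedule `E ≥ ε₁` of the hypothesis, its anchor hypothesis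
by (i); the crux returns `β₁` and, at the `β ≥ β₁` of (ii), one rate `m > 0` and a Leg A constant `C(w)` at the
extent `T'` of (ii); along the tori of (ii) the connected correlation is `≥ δ` at distance `n ≥ L/4 → ∞` yet
`≤ C e^{-m n}` — impossible once `n > C/(δ m)`. -/
theorem AdiabaticContinuity_false_of_ThermalWindowLRO :
    ThermalWindowLRO → ¬ Summit.QuantumFields.YangMills.Theses.SmallCircleAnchor.AdiabaticContinuity := by
  rintro ⟨G, _, _, _, _, hG, r, V, hV, T, hT, hH⟩ hAC
  haveI := hT
  obtain ⟨ε₁, hε₁⟩ := hAC G hG r V hV T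
  obtain ⟨E, hE, ⟨β₀, hanch⟩, hLRO⟩ := hH ε₁
  obtain ⟨β₁, hβ₁⟩ := hε₁ E hE β₀ hanch
  obtain ⟨β, hβ, T', hT', hTT', w, δ, hδ, hwin⟩ := hLRO β₁
  haveI := hT'
  obtain ⟨m, hm, hLegA, -⟩ := hβ₁ β hβ
  obtain ⟨C, hC⟩ := hLegA T' hTT' w
  -- a torus large enough that `n ≥ L/4 > C/(δ m)`
  obtain ⟨L, hL, hL₀, c, F₁, F₂, hF₁, hF₂, n, hn, hLn, hbig⟩ := hwin (4 * (⌈C / (δ * m)⌉₊ + 1))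
  haveI := hL
  have hbound := @hC L hL (show NeZero T' from hT') c F₁ F₂ hF₁ hF₂ n hn
  have hn' : C / (δ * m) < n := by
    have h1 : (⌈C / (δ * m)⌉₊ : ℝ) + 1 ≤ n := by
      have : 4 * (⌈C / (δ * m)⌉₊ + 1) ≤ 4 * n := hL₀.trans hLn
      exact_mod_cast Nat.le_of_mul_le_mul_left this (by norm_num)
    exact (Nat.le_ceil _).trans_lt (by linarith)
  exact not_le_mul_exp_neg hδ hm hn' (hbig.trans hbound)

end Summit.QuantumFields.YangMills.Theorems.AdiabaticContinuity.Negative
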